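import Literature.AnabelianGeometry.SemiGraphs.Prop36HypothesesWitness
import Literature.AnabelianGeometry.SemiGraphs.TemperedPiChartExists

/-!
# The Prop. 3.6 / Thm. 3.7 witness carries a tempered fundamental group chart — unconditionally

Mochizuki, *Semi-graphs of anabelioids*, Publ. RIMS **42** (2006) [MochizukiSemiAnbd2006], Prop. 3.6
(i)(ii) p. 262 (kurims p. 38) and Thm. 3.7 p. 264 (kurims p. 40).

PROOF-ONLY follow-through of `Prop36HypothesesWitness.lean` (cell abc-iut, layer L3, row WIT-1a).
There, `nonempty_temperedPiChart_affWitness` took the named fact `ExistsTemperedPiChart`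
(Prop. 3.6 (i)(ii)) as a hypothesis; that fact is now a THEOREM of the tree
(`ExistsTemperedPiChart_holds`, `TemperedPiChartExists.lean`), so the witness
`affWitness p` (one vertex with anabelioid `B(Aff(ℤ_p))`, no edges) carries a tempered fundamental
group chart outright.  Consequently the JOINT antecedent «`Thm37Hypotheses` and a `TemperedPiChart`»
over which the named facts `VerticialInjective`, `VerticialDistinct`, `CompactInVerticial`,
`MaximalCompactIffVerticial`, `TemperedPiSlim`, `TemperedPiResiduallyFinite` (all in
`TemperedVerticial.lean`) quantify is inhabited in the kernel: none of them is vacuously true for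
want of an instance of its hypotheses.  A witness certifies non-vacuity, nothing more; no statement
of the paper is touched, strengthened or assumed.  Nothing here takes a side on [IUTchIII] Cor. 3.12.
-/

noncomputable section

namespace Literature.AnabelianGeometry.SemiGraphs

namespace ProfiniteSemiGraph

variable (p : ℕ) [Fact p.Prime]

/-- The witness `affWitness p` carries a tempered fundamental group chart (Prop. 3.6 (i)(ii) applied
to `affWitness_prop36Hypotheses`), unconditionally. [cite: MochizukiSemiAnbd2006, Prop 3.6(ii) p.38] -/
theorem nonempty_temperedPiChart_affWitness_holds : Nonempty (TemperedPiChart (affWitness p)) :=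
  nonempty_temperedPiChart_affWitness (p := p) ExistsTemperedPiChart_holds

/-- The canonical chart of the witness is the tree's `temperedPiChart` at the witness's Prop. 3.6
hypotheses; in particular its group is `(affWitness p).temperedPi _`.
[cite: MochizukiSemiAnbd2006, Prop 3.6(ii) p.38] -/
theorem temperedPiChart_affWitness_G :
    ((affWitness p).temperedPiChart affWitness_prop36Hypotheses).G =
      (affWitness p).temperedPi affWitness_prop36Hypotheses :=
  rfl

/-- Non-vacuity of the joint antecedent «Prop. 3.6 hypotheses + a chart» (the shape of
`TemperedPiSlim`, `TemperedPiResiduallyFinite`). [cite: MochizukiSemiAnbd2006, Prop 3.6 p.38] -/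
theorem exists_prop36Hypotheses_and_chart :
    ∃ 𝒢 : ProfiniteSemiGraph.{0}, 𝒢.Prop36Hypotheses ∧ Nonempty (TemperedPiChart 𝒢) :=
  ⟨@affWitness 2 ⟨Nat.prime_two⟩, @affWitness_prop36Hypotheses 2 ⟨Nat.prime_two⟩,
    @nonempty_temperedPiChart_affWitness_holds 2 ⟨Nat.prime_two⟩⟩

/-- Non-vacuity of the joint antecedent «Thm. 3.7 hypotheses + a chart» (the shape of
`VerticialInjective`, `VerticialDistinct`, `CompactInVerticial`, `MaximalCompactIffVerticial`).
[cite: MochizukiSemiAnbd2006, Thm 3.7 p.40] -/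
theorem exists_thm37Hypotheses_and_chart :
    ∃ 𝒢 : ProfiniteSemiGraph.{0}, 𝒢.Thm37Hypotheses ∧ Nonempty (TemperedPiChart 𝒢) :=
  ⟨@affWitness 2 ⟨Nat.prime_two⟩, @affWitness_thm37Hypotheses 2 ⟨Nat.prime_two⟩,
    @nonempty_temperedPiChart_affWitness_holds 2 ⟨Nat.prime_two⟩⟩

/-- The same with the chart and a vertex as data: the binder prefix
`(𝒢) (_ : 𝒢.Thm37Hypotheses) (c : TemperedPiChart 𝒢) (v : 𝒢.graph.Vertex)` of
`VerticialInjective` is instantiable. [cite: MochizukiSemiAnbd2006, Thm 3.7(i) p.40] -/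
theorem exists_thm37Hypotheses_chart_vertex :
    ∃ (𝒢 : ProfiniteSemiGraph.{0}) (_ : 𝒢.Thm37Hypotheses) (_ : TemperedPiChart 𝒢),
      Nonempty 𝒢.graph.Vertex := by
  obtain ⟨c⟩ := @nonempty_temperedPiChart_affWitness_holds 2 ⟨Nat.prime_two⟩
  exact ⟨@affWitness 2 ⟨Nat.prime_two⟩, @affWitness_thm37Hypotheses 2 ⟨Nat.prime_two⟩, c,
    ⟨PUnit.unit⟩⟩

end ProfiniteSemiGraph

end Literature.AnabelianGeometry.SemiGraphs

end
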